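import Literature.Combinatorics.Enumerative.LaplacianCharpolyForestExpansion
import HarnessLib

/-!
# The matrix-forest theorem: `(I + L)⁻¹` is the matrix of relative forest accessibilities
# (Chebotarev–Shamis; Chebotarev–Agaev 2002, Theorem 3)

Lane `lit-hodgefound`, seat p23, generation 47, row g47-#13 of the programme «Tree and forest formulas
for finite Markov chains», in the vocabulary of `Combinatorics/Enumerative/MatrixForestTheoremInverse`
(`forestWeight a R = w(R)`, `forestWeightTo a R i j = w_{ij}(R)`: the weight of the spanning in-forests
with root set `R`, resp. of those among them in which `i` lies in the tree rooted at `j`).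

## Source, verbatim ([ChebotarevAgaev2002], held text `paper:arxiv-math_0508178`, §2 p. 4, §4 p. 7)

«`F^{i→*j}_k` will designate the set of all in-forests with `k` arcs where `i` belongs to a tree
converging to `j`; `F^{i→*j} = ∪_{k=0}^{n−d} F^{i→*j}_k` is the set of such in-forests with any number of
arcs. […] `σ = ε(F→*) = Σ_{k=0}^{n−d} σ_k` […] the matrices `Q_k = (q^k_{ij})`, `q^k_{ij} = ε(F^{i→*j}_k)`,
`Q = Σ_k Q_k`, `J = σ^{−1} Q` [the matrix of relative forest accessibilities] […]
**Theorem 3** [CheSha95a, CheSha97]. `Q = adj(I + L)` and `σ = det(I + L)`. Thus, `J = (I + L)^{−1}`.»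

## What is here (arbitrary arc weights `a : V → V → S` in a commutative ring; a field for the inverse)

* `forestWeightTo_eq_sum_mul_forestWeightTo_insert` — **removing the arc out of `i`**: for `i ∉ R`,
  `j ∈ R`, `w_{ij}(R) = Σ_{k ≠ i} a_{ik} · w_{kj}(R ∪ {i})` (a bijection `f ↦ (f(i), f with i cut)`);
* `one_add_wLaplacian_mul_accessibility` — **`(I + L) · Q = σ · I`** with
  `Q_{kj} = Σ_{R ∋ j} w_{kj}(R) = ε(F^{k→*j})` and `σ = Σ_R w(R) = ε(F→*)` (from the arc-removal identity,
  the harmonic identity (2.9) `outWeight_mul_forestWeightTo` and Lemma 2.2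
  `outWeight_mul_forestWeight_insert` of the tree);
* **`inv_one_add_wLaplacian_apply`** — Theorem 3: over a field with `σ ≠ 0`,
  **`((I + L)⁻¹)_{ij} = ε(F^{i→*j}) / ε(F→*)`**; with `det(I + L) = σ` (tree: `det_one_add_wLaplacian`).

* §4 (appended, row g47-#14): **Proposition 1** («every row sum of `Q_k` is `σ_k`»; `J`, `J(τ)` are row
  stochastic): `sum_forestWeightTo_filter_mem` (`Σ_j Q_{ij} = σ`), `sum_forestWeightTo_filter_mem_card`
  (`Σ_j q^k_{ij} = σ_k`), `sum_inv_one_add_wLaplacian` (`Σ_j ((I+L)⁻¹)_{ij} = 1`); and **Theorem 3′**,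
  inverse part: `inv_one_add_smul_wLaplacian_apply` — `((I + τL)⁻¹)_{ij} = Σ_{R ∋ j} τ^{n−|R|} w_{ij}(R) /
  Σ_R τ^{n−|R|} w(R)` (`= J(τ)_{ij}`), through `forestWeightTo_smul`.

* §5 (appended, row g47-#16): **`Q = adj(I + L)` itself** — `adjugate_one_add_wLaplacian`, in every
  commutative ring in which `σ` is (left-)regular (`(I+L)·Q = σ·I = (I+L)·adj(I+L)` and `I + L` is
  left-cancellable, Mathlib's `isRegular_of_isLeftRegular_det`), whence the ROW form
  `accessibility_mul_one_add_wLaplacian` (`Q·(I + L) = σ·I`); unconditional versions over a field with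
  `σ ≠ 0` and for non-negative weights in an ordered field (`σ ≥ w(V) = 1`, `one_le_sum_forestWeight`).

THEOREMS ONLY (no definition, no named fact, no instance).

## References

* [ChebotarevAgaev2002] §2 (relative forest accessibilities; Proposition 1), §4 Theorems 3, 3′; P. Chebotarev,
  E. Shamis, *The matrix-forest theorem and measuring relations in small social groups*, Autom. Remote
  Control 58 (1997) [CheSha97].
* [PitmanTang2018] Thm 1.2 (1.5), Lemma 2.2, eq. (2.9) (tree: `MatrixForestTheoremInverse`).
-/

namespace Literature.Combinatorics.Enumerative

open Finset Function Matrix Literature.Combinatorics.SimpleGraph.WeightedMatrixForest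

variable {V : Type*} [Fintype V] [DecidableEq V]

/-! ### §1 Removing the arc out of a vertex -/

section ArcRemoval

variable {S : Type*} [CommRing S] (a : V → V → S) {R : Finset V}

open Classical in
/-- **Removing the arc out of `i`**: for `i ∉ R` and a root `j ∈ R`,
`w_{ij}(R) = Σ_{k ≠ i} a_{ik} · w_{kj}(R ∪ {i})` — a forest with root set `R` in which `i` leads to `j`
is the same as an arc `i → k` together with a forest with root set `R ∪ {i}` in which `k` leads to `j`
(delete / restore the arc out of `i`). [cite: ChebotarevAgaev2002, §4 (proof of Theorem 3 via the
all minors matrix tree theorem: in-forests of the ground extension)] [cite: PitmanTang2018, §2 (proof of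
Lemma 2.2: «remove this edge `j → k` from **f′** to obtain two trees»)] -/
theorem forestWeightTo_eq_sum_mul_forestWeightTo_insert {i j : V} (hi : i ∉ R) (hj : j ∈ R) :
    forestWeightTo a R i j = ∑ k ∈ univ.erase i, a i k * forestWeightTo a (insert i R) k j := by
  have hij : i ≠ j := fun h => hi (h ▸ hj)
  have hiRc : i ∈ Rᶜ := mem_compl.2 hi
  set F := forests (univ : Finset V) R with hF
  set F' := forests (univ : Finset V) (insert i R) with hF'
  set Y := ((univ.erase i) ×ˢ F').filter (fun q : V × (V → V) => Leads q.2 q.1 j) with hY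
  have hYm : ∀ q : V × (V → V), q ∈ Y ↔
      q.1 ∈ univ.erase i ∧ q.2 ∈ F'.filter (fun τ => Leads τ q.1 j) := by
    intro q
    simp only [hY, mem_filter, mem_product, and_assoc]
  rw [forestWeightTo_def]
  simp_rw [forestWeightTo_def a (insert i R), mul_sum]
  rw [show (∑ k ∈ univ.erase i, ∑ τ ∈ F'.filter (fun τ => Leads τ k j),
        a i k * ∏ v ∈ (insert i R)ᶜ, a v (τ v)) = ∑ q ∈ Y, a i q.1 * ∏ v ∈ (insert i R)ᶜ, a v (q.2 v) from
      (sum_finset_product' (f := fun k τ => a i k * ∏ v ∈ (insert i R)ᶜ, a v (τ v)) Y (univ.erase i)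
        (fun k => F'.filter fun τ => Leads τ k j) hYm).symm]
  refine sum_nbij' (fun τ => (τ i, update τ i i)) (fun q => update q.2 i q.1) ?_ ?_ ?_ ?_ ?_
  · intro τ hτ
    rw [mem_filter, mem_forests] at hτ
    obtain ⟨hτ, hτij⟩ := hτ
    rw [hYm]
    simp only [mem_filter, mem_erase, mem_univ, and_true, hF', mem_forests]
    refine ⟨hτ.apply_ne_self hi, hτ.update_self_insert i, ?_⟩
    rw [leads_update_iff_of_not_leads (hτ.not_leads_apply_self hi)]
    exact leads_apply_of_leads hi hj hτij
  · rintro ⟨k, τ'⟩ hq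
    rw [hYm] at hq
    simp only [mem_filter, mem_erase, mem_univ, and_true, hF', mem_forests] at hq
    obtain ⟨hki, hτ', hkj⟩ := hq
    have hki' : ¬ Leads τ' k i := fun h =>
      hij (hτ'.root_unique (mem_insert_self i R) (mem_insert_of_mem hj) h hkj)
    dsimp only
    rw [mem_filter, mem_forests]
    refine ⟨?_, ?_⟩
    · have h := hτ'.update_erase hki'
      rwa [erase_insert hi] at h
    · rw [leads_iff_eq_or_leads_apply, update_self, leads_update_iff_of_not_leads hki']
      exact Or.inr hkj
  · intro τ _
    simp only [update_idem, update_eq_self]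
  · rintro ⟨k, τ'⟩ hq
    rw [hYm] at hq
    simp only [mem_filter, mem_erase, mem_univ, and_true, hF', mem_forests] at hq
    have hroot : τ' i = i := (isForestOn_univ_iff.1 hq.2.1).1 i (mem_insert_self i R)
    refine Prod.ext (update_self _ _ _) ?_
    show update (update τ' i k) i i = τ'
    rw [update_idem, show update τ' i i = update τ' i (τ' i) by rw [hroot], update_eq_self]
  · intro τ _
    show ∏ v ∈ Rᶜ, a v (τ v) = a i (τ i) * ∏ v ∈ (insert i R)ᶜ, a v (update τ i i v)
    rw [Finset.compl_insert, ← mul_prod_erase Rᶜ (fun v => a v (τ v)) hiRc]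
    congr 1
    exact prod_congr rfl fun v hv => by rw [update_of_ne (ne_of_mem_erase hv)]

end ArcRemoval

/-! ### §2 `(I + L) · Q = σ · I` -/

section Accessibility

variable {S : Type*} [CommRing S] (a : V → V → S)

/-- For `i ∉ R`, `j ∈ R`: `Σ_k L_{ik} w_{kj}(R) = 0` — the harmonic identity (2.9) as a matrix row.
[cite: PitmanTang2018, eq. (2.9)] [cite: ChebotarevAgaev2002, §4 Theorem 3] -/
theorem sum_wLaplacian_mul_forestWeightTo_of_not_mem {R : Finset V} {i j : V} (hi : i ∉ R)
    (hj : j ∈ R) : ∑ k, wLaplacian a i k * forestWeightTo a R k j = 0 := by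
  rw [← add_sum_erase _ _ (mem_univ i), wLaplacian_apply_self, outWeight_mul_forestWeightTo a hi hj,
    ← sum_add_distrib]
  refine sum_eq_zero fun k hk => ?_
  rw [wLaplacian_apply_of_ne _ (ne_of_mem_erase hk).symm, neg_mul, add_neg_cancel]

/-- For a root `i ∈ R`: `Σ_k L_{ik} w_{kj}(R) = [j = i] (Σ_{k≠i} a_{ik}) w(R) − Σ_{k ≠ i} a_{ik} w_{kj}(R)`.
[cite: PitmanTang2018, Lemma 2.2 (the row of a root)] [cite: ChebotarevAgaev2002, §4 Theorem 3] -/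
theorem sum_wLaplacian_mul_forestWeightTo_of_mem {R : Finset V} {i : V} (hi : i ∈ R) (j : V) :
    ∑ k, wLaplacian a i k * forestWeightTo a R k j =
      (if j = i then (∑ k ∈ univ.erase i, a i k) * forestWeight a R else 0) -
        ∑ k ∈ univ.erase i, a i k * forestWeightTo a R k j := by
  rw [← add_sum_erase _ _ (mem_univ i), wLaplacian_apply_self, forestWeightTo_of_mem_roots a R hi,
    mul_ite, mul_zero, sub_eq_add_neg, ← sum_neg_distrib]
  congr 1
  exact sum_congr rfl fun k hk => by rw [wLaplacian_apply_of_ne _ (ne_of_mem_erase hk).symm, neg_mul]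

/-- Lemma 2.2 at a root `i ∈ R`, rearranged: `(Σ_{k≠i} a_{ik}) w(R) − Σ_{k≠i} a_{ik} w_{ki}(R) = w(R ∖ {i})`.
[cite: PitmanTang2018, Lemma 2.2] -/
theorem outWeight_mul_forestWeight_sub {R : Finset V} {i : V} (hi : i ∈ R) :
    (∑ k ∈ univ.erase i, a i k) * forestWeight a R -
        ∑ k ∈ univ.erase i, a i k * forestWeightTo a R k i = forestWeight a (R.erase i) := by
  have h := outWeight_mul_forestWeight_insert a (notMem_erase i R)
  rw [insert_erase hi] at h
  rw [h, sum_subset (s₁ := Rᶜ) (s₂ := univ.erase i) (f := fun k => a i k * forestWeightTo a R k i)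
    (fun k hk => mem_erase.2 ⟨fun h' => (mem_compl.1 hk) (h' ▸ hi), mem_univ k⟩) ?_, add_sub_cancel_right]
  intro k hk hkc
  have hkR : k ∈ R := not_not.1 fun h' => hkc (mem_compl.2 h')
  show a i k * forestWeightTo a R k i = 0
  rw [forestWeightTo_of_mem_roots a R hkR, if_neg (ne_of_mem_erase hk).symm, mul_zero]

/-- Re-indexing `R ↦ R ∪ {i}` with the arc-removal identity: for `i ≠ j`,
`Σ_{R ∋ j, R ∌ i} w_{ij}(R) = Σ_{R ∋ i, j} Σ_{k ≠ i} a_{ik} w_{kj}(R)`. [cite: ChebotarevAgaev2002, §4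
Theorem 3 (proof)] -/
theorem sum_forestWeightTo_not_mem_eq {i j : V} (hij : i ≠ j) :
    ∑ R ∈ (univ : Finset (Finset V)).filter (fun R => j ∈ R ∧ i ∉ R), forestWeightTo a R i j =
      ∑ R ∈ (univ : Finset (Finset V)).filter (fun R => j ∈ R ∧ i ∈ R),
        ∑ k ∈ univ.erase i, a i k * forestWeightTo a R k j := by
  refine sum_nbij' (fun R => insert i R) (fun R => R.erase i) ?_ ?_ ?_ ?_ ?_
  · intro R hR
    rw [mem_filter] at hR ⊢
    exact ⟨mem_univ _, mem_insert_of_mem hR.2.1, mem_insert_self i R⟩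
  · intro R hR
    rw [mem_filter] at hR ⊢
    exact ⟨mem_univ _, mem_erase.2 ⟨hij.symm, hR.2.1⟩, notMem_erase i R⟩
  · intro R hR
    rw [mem_filter] at hR
    exact erase_insert hR.2.2
  · intro R hR
    rw [mem_filter] at hR
    exact insert_erase hR.2.2
  · intro R hR
    rw [mem_filter] at hR
    exact forestWeightTo_eq_sum_mul_forestWeightTo_insert a hR.2.2 hR.2.1

/-- **`(I + L) · Q = σ · I`**, `Q_{kj} = Σ_{R ∋ j} w_{kj}(R) = ε(F^{k→*j})` the total weight of the spanning
in-forests in which `k` lies in the tree rooted at `j`, `σ = Σ_R w(R) = ε(F→*)` the total weight of all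
spanning in-forests — Theorem 3 cleared of denominators (`Q = adj(I + L)`, `σ = det(I + L)`), for
arbitrary arc weights in a commutative ring. [cite: ChebotarevAgaev2002, §4 Theorem 3 («`Q = adj(I+L)`
and `σ = det(I+L)`»)] -/
theorem one_add_wLaplacian_mul_accessibility :
    (1 + wLaplacian a) *
        Matrix.of (fun k j : V =>
          ∑ R ∈ (univ : Finset (Finset V)).filter (fun R => j ∈ R), forestWeightTo a R k j) =
      (∑ R : Finset V, forestWeight a R) • (1 : Matrix V V S) := by
  ext i j
  rw [Matrix.mul_apply, Matrix.smul_apply, smul_eq_mul]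
  simp only [Matrix.add_apply, of_apply, add_mul, sum_add_distrib, Matrix.one_apply, ite_mul, one_mul,
    zero_mul, sum_ite_eq, mem_univ, if_true]
  -- `Σ_k L_ik Q_kj = Σ_{R ∋ j} Σ_k L_ik w_kj(R)`, split by `i ∈ R`
  rw [show (∑ k, wLaplacian a i k *
        ∑ R ∈ (univ : Finset (Finset V)).filter (fun R => j ∈ R), forestWeightTo a R k j) =
      ∑ R ∈ (univ : Finset (Finset V)).filter (fun R => j ∈ R), ∑ k, wLaplacian a i k * forestWeightTo a R k j by
    simp_rw [mul_sum]; exact sum_comm]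
  rw [← sum_filter_add_sum_filter_not ((univ : Finset (Finset V)).filter (fun R => j ∈ R)) (fun R => i ∈ R),
    ← sum_filter_add_sum_filter_not ((univ : Finset (Finset V)).filter (fun R => j ∈ R)) (fun R => i ∈ R)
      (fun R => ∑ k, wLaplacian a i k * forestWeightTo a R k j),
    filter_filter, filter_filter]
  rw [sum_congr rfl fun R hR =>
      sum_wLaplacian_mul_forestWeightTo_of_mem a (R := R) ((mem_filter.1 hR).2.2) j,
    sum_congr rfl fun R hR =>
      sum_wLaplacian_mul_forestWeightTo_of_not_mem a (R := R) ((mem_filter.1 hR).2.2) ((mem_filter.1 hR).2.1),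
    sum_const_zero, add_zero,
    sum_congr rfl fun R hR => forestWeightTo_of_mem_roots a R ((mem_filter.1 hR).2.2) j]
  by_cases hij : i = j
  · subst hij
    -- `Σ_{R ∋ i} [(Σ a) w(R) − Σ a w_ki(R)] = Σ_{R ∋ i} w(R ∖ i) = Σ_{R ∌ i} w(R)`
    have hkey : ∑ R ∈ (univ : Finset (Finset V)).filter (fun R => i ∈ R),
        ((∑ k ∈ univ.erase i, a i k) * forestWeight a R -
          ∑ k ∈ univ.erase i, a i k * forestWeightTo a R k i) =
        ∑ R ∈ (univ : Finset (Finset V)).filter (fun R => i ∉ R), forestWeight a R := by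
      rw [sum_congr rfl fun R hR => outWeight_mul_forestWeight_sub a (R := R) (mem_filter.1 hR).2]
      refine sum_nbij' (fun R => R.erase i) (fun R => insert i R) ?_ ?_ ?_ ?_ fun _ _ => rfl
      · intro R _
        exact mem_filter.2 ⟨mem_univ _, notMem_erase i R⟩
      · intro R _
        exact mem_filter.2 ⟨mem_univ _, mem_insert_self i R⟩
      · intro R hR
        exact insert_erase (mem_filter.1 hR).2
      · intro R hR
        exact erase_insert (mem_filter.1 hR).2
    simp only [if_true, mul_one]
    rw [show ((univ : Finset (Finset V)).filter fun R => i ∈ R ∧ i ∉ R) = ∅ from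
        filter_eq_empty_iff.2 fun R _ h => h.2 h.1, sum_empty, add_zero,
      show ((univ : Finset (Finset V)).filter fun R => i ∈ R ∧ i ∈ R) =
        (univ : Finset (Finset V)).filter fun R => i ∈ R from filter_congr fun R _ => and_self_iff,
      hkey]
    exact sum_filter_add_sum_filter_not _ _ _
  · rw [if_neg hij, mul_zero]
    simp only [if_neg (Ne.symm hij), zero_sub, sum_const_zero, zero_add, sum_neg_distrib]
    rw [sum_forestWeightTo_not_mem_eq a hij]
    exact add_neg_cancel _

end Accessibility

/-! ### §3 Theorem 3: `(I + L)⁻¹ = J`, the matrix of relative forest accessibilities -/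

section Inverse

variable {K : Type*} [Field K] (a : V → V → K)

/-- **Theorem 3 (the matrix-forest theorem, Chebotarev–Shamis): `(I + L)⁻¹ = J = σ⁻¹ Q`**, i.e.
`((I + L)⁻¹)_{ij} = ε(F^{i→*j}) / ε(F→*)` — the relative weight of the spanning in-forests in which `i`
lies in the tree rooted at `j` — over a field in which `σ = Σ_R w(R) = det(I + L) ≠ 0`.
[cite: ChebotarevAgaev2002, §4 Theorem 3 («Thus, `J = (I + L)^{−1}`»)] -/
theorem inv_one_add_wLaplacian_apply (hσ : ∑ R : Finset V, forestWeight a R ≠ 0) (i j : V) :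
    (1 + wLaplacian a)⁻¹ i j =
      (∑ R ∈ (univ : Finset (Finset V)).filter (fun R => j ∈ R), forestWeightTo a R i j) /
        ∑ R : Finset V, forestWeight a R := by
  have h := one_add_wLaplacian_mul_accessibility a
  have hinv : (1 + wLaplacian a)⁻¹ = (∑ R : Finset V, forestWeight a R)⁻¹ •
      Matrix.of (fun k j : V =>
        ∑ R ∈ (univ : Finset (Finset V)).filter (fun R => j ∈ R), forestWeightTo a R k j) :=
    Matrix.inv_eq_right_inv (by rw [Matrix.mul_smul, h, smul_smul, inv_mul_cancel₀ hσ, one_smul])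
  rw [hinv, Matrix.smul_apply, of_apply, smul_eq_mul, div_eq_inv_mul]

/-- `det(I + L) ≠ 0 ↔ σ ≠ 0`: the hypothesis of Theorem 3 in either language.
[cite: ChebotarevAgaev2002, §4 Theorem 3 («`σ = det(I+L)`»)] -/
theorem det_one_add_wLaplacian_ne_zero_iff :
    (1 + wLaplacian a).det ≠ 0 ↔ ∑ R : Finset V, forestWeight a R ≠ 0 := by
  rw [det_one_add_wLaplacian]

end Inverse

/-! ### §4 Proposition 1 (row sums) and Theorem 3′ (the parametric inverse `J(τ) = (I + τL)⁻¹`) -/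

section RowSums

variable {S : Type*} [CommRing S] (a : V → V → S)

/-- **«Every row sum of `Q` is `σ`»**: `Σ_j ε(F^{i→*j}) = ε(F→*)` — every vertex lies in exactly one tree of
each spanning in-forest. [cite: ChebotarevAgaev2002, §2 Proposition 1 (proof: «Every row sum of `Q_k` is
`σ_k`»)] -/
theorem sum_forestWeightTo_filter_mem (i : V) :
    ∑ j, ∑ R ∈ (univ : Finset (Finset V)).filter (fun R => j ∈ R), forestWeightTo a R i j =
      ∑ R : Finset V, forestWeight a R := by
  simp_rw [sum_filter]
  rw [sum_comm]
  refine sum_congr rfl fun R _ => ?_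
  rw [← sum_filter, filter_mem_eq_inter, univ_inter, sum_forestWeightTo]

/-- **«Every row sum of `Q_k` is `σ_k`»** — graded by the number of roots `m = n − k`:
`Σ_j Σ_{R ∋ j, |R| = m} w_{ij}(R) = Σ_{|R| = m} w(R)`. [cite: ChebotarevAgaev2002, §2 Proposition 1
(proof)] -/
theorem sum_forestWeightTo_filter_mem_card (i : V) (m : ℕ) :
    ∑ j, ∑ R ∈ ((univ : Finset V).powersetCard m).filter (fun R => j ∈ R), forestWeightTo a R i j =
      ∑ R ∈ (univ : Finset V).powersetCard m, forestWeight a R := by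
  simp_rw [sum_filter]
  rw [sum_comm]
  refine sum_congr rfl fun R _ => ?_
  rw [← sum_filter, filter_mem_eq_inter, univ_inter, sum_forestWeightTo]

/-- Scaling all arc weights by `τ` scales `w_{ij}(R)` by `τ^{n−|R|}`. [cite: ChebotarevAgaev2002, §4
(proof of Theorem 3′: «`ε′_{ij}(τ) = τ ε_{ij}`»)] -/
theorem forestWeightTo_smul (t : S) (R : Finset V) (i j : V) :
    forestWeightTo (fun u v => t * a u v) R i j = t ^ (Fintype.card V - R.card) * forestWeightTo a R i j := by
  rw [forestWeightTo_def, forestWeightTo_def, mul_sum]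
  refine sum_congr rfl fun τ _ => ?_
  rw [prod_mul_distrib, prod_const, card_compl]

end RowSums

section Parametric

variable {K : Type*} [Field K] (a : V → V → K)

/-- **`J = (I + L)⁻¹` is row stochastic**: `Σ_j ((I + L)⁻¹)_{ij} = 1` (over a field with `σ ≠ 0`).
[cite: ChebotarevAgaev2002, §2 Proposition 1 («The matrices `J_k`, `J`, and `J(τ)` are row
stochastic»)] -/
theorem sum_inv_one_add_wLaplacian (hσ : ∑ R : Finset V, forestWeight a R ≠ 0) (i : V) :
    ∑ j, (1 + wLaplacian a)⁻¹ i j = 1 := by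
  simp_rw [inv_one_add_wLaplacian_apply a hσ]
  rw [← sum_div, sum_forestWeightTo_filter_mem, div_self hσ]

/-- **Theorem 3′ (parametric matrix-forest theorem), inverse part: `J(τ) = (I + τL)⁻¹`**, i.e.
`((I + τL)⁻¹)_{ij} = Q(τ)_{ij} / σ(τ)` with `Q(τ)_{ij} = Σ_{R ∋ j} τ^{n−|R|} w_{ij}(R) = Σ_k τ^k q^k_{ij}` and
`σ(τ) = Σ_R τ^{n−|R|} w(R)`, whenever `σ(τ) ≠ 0`. [cite: ChebotarevAgaev2002, §4 Theorem 3′ («for any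
`τ ≥ 0`, `J(τ) = (I + τL)^{−1}`»)] -/
theorem inv_one_add_smul_wLaplacian_apply (t : K)
    (hσ : ∑ R : Finset V, t ^ (Fintype.card V - R.card) * forestWeight a R ≠ 0) (i j : V) :
    (1 + t • wLaplacian a)⁻¹ i j =
      (∑ R ∈ (univ : Finset (Finset V)).filter (fun R => j ∈ R),
          t ^ (Fintype.card V - R.card) * forestWeightTo a R i j) /
        ∑ R : Finset V, t ^ (Fintype.card V - R.card) * forestWeight a R := by
  have hσ' : ∑ R : Finset V, forestWeight (fun u v => t * a u v) R ≠ 0 := by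
    simp_rw [forestWeight_smul]
    exact hσ
  rw [← wLaplacian_smul, inv_one_add_wLaplacian_apply _ hσ']
  simp_rw [forestWeightTo_smul, forestWeight_smul]

end Parametric

/-! ### §5 `Q = adj(I + L)` and the row identity `Q · (I + L) = σ · I` -/

section Adjugate

variable {S : Type*} [CommRing S] (a : V → V → S)

/-- **Theorem 3, adjugate part: `Q = adj(I + L)`** — in any commutative ring in which `σ = det(I + L)` is
left-regular: both `Q` and `adj(I + L)` solve `(I + L)·X = σ·I`, and `I + L` is left-cancellable.
[cite: ChebotarevAgaev2002, §4 Theorem 3 («`Q = adj(I+L)`»)] -/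
theorem adjugate_one_add_wLaplacian (hσ : IsLeftRegular (∑ R : Finset V, forestWeight a R)) :
    (1 + wLaplacian a).adjugate =
      Matrix.of (fun k j : V =>
        ∑ R ∈ (univ : Finset (Finset V)).filter (fun R => j ∈ R), forestWeightTo a R k j) := by
  have hdet : (1 + wLaplacian a).det = ∑ R : Finset V, forestWeight a R := det_one_add_wLaplacian a
  have hreg : IsRegular (1 + wLaplacian a) :=
    Matrix.isRegular_of_isLeftRegular_det (by rw [hdet]; exact hσ)
  refine hreg.left ?_
  show (1 + wLaplacian a) * (1 + wLaplacian a).adjugate = (1 + wLaplacian a) * _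
  rw [one_add_wLaplacian_mul_accessibility, mul_adjugate, hdet]

/-- **`Q · (I + L) = σ · I`** (the row form of Theorem 3: `adj(I+L)·(I+L) = det(I+L)·I`), for `σ`
left-regular. [cite: ChebotarevAgaev2002, §4 Theorem 3] -/
theorem accessibility_mul_one_add_wLaplacian (hσ : IsLeftRegular (∑ R : Finset V, forestWeight a R)) :
    Matrix.of (fun k j : V =>
        ∑ R ∈ (univ : Finset (Finset V)).filter (fun R => j ∈ R), forestWeightTo a R k j) *
        (1 + wLaplacian a) =
      (∑ R : Finset V, forestWeight a R) • (1 : Matrix V V S) := by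
  rw [← adjugate_one_add_wLaplacian a hσ, adjugate_mul, det_one_add_wLaplacian]

end Adjugate

section AdjugateField

variable {K : Type*} [Field K] (a : V → V → K)

/-- `Q = adj(I + L)` over a field with `σ ≠ 0`. [cite: ChebotarevAgaev2002, §4 Theorem 3] -/
theorem adjugate_one_add_wLaplacian_of_ne_zero (hσ : ∑ R : Finset V, forestWeight a R ≠ 0) :
    (1 + wLaplacian a).adjugate =
      Matrix.of (fun k j : V =>
        ∑ R ∈ (univ : Finset (Finset V)).filter (fun R => j ∈ R), forestWeightTo a R k j) :=
  adjugate_one_add_wLaplacian a (IsRegular.of_ne_zero hσ).left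

/-- For non-negative arc weights `σ ≥ w(V) = 1`: the empty in-forest alone contributes `1`
(«`I + τL` with `τ ≥ 0` are nonsingular M-matrices»). [cite: ChebotarevAgaev2002, §4 («It is easily
seen that `I + τL` with `τ ≥ 0` are nonsingular M-matrices»)] -/
theorem one_le_sum_forestWeight {F : Type*} [Field F] [LinearOrder F] [IsStrictOrderedRing F]
    (a : V → V → F) (ha : ∀ x y, 0 ≤ a x y) : 1 ≤ ∑ R : Finset V, forestWeight a R := by
  rw [← forestWeight_univ a]
  exact single_le_sum (fun R _ => forestWeight_nonneg_of_nonneg a ha R) (mem_univ _)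

/-- `Q = adj(I + L)` for non-negative arc weights in an ordered field, unconditionally.
[cite: ChebotarevAgaev2002, §4 Theorem 3] -/
theorem adjugate_one_add_wLaplacian_of_nonneg {F : Type*} [Field F] [LinearOrder F] [IsStrictOrderedRing F]
    (a : V → V → F) (ha : ∀ x y, 0 ≤ a x y) :
    (1 + wLaplacian a).adjugate =
      Matrix.of (fun k j : V =>
        ∑ R ∈ (univ : Finset (Finset V)).filter (fun R => j ∈ R), forestWeightTo a R k j) :=
  adjugate_one_add_wLaplacian_of_ne_zero a (zero_lt_one.trans_le (one_le_sum_forestWeight a ha)).ne'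

end AdjugateField

end Literature.Combinatorics.Enumerative
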